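import Literature.Computability.Complexity.Promise
import Literature.Computability.Complexity.ProbabilisticClasses
import Literature.Computability.MetaComplexity.DistProblems
import HarnessLib

/-!
# Complexity meta: derandomisation from average-case easiness of `NP` (Buhrman–Fortnow–Pavan)

Topic `Literature/Computability/MetaComplexity`, companion to `DistProblems.lean` (`DistNP`, `AvgP`)
and `Literature/Computability/Complexity/Promise.lean` (`PromiseP`, the textbook promise-`BPP`
`PromiseBPP'`). Vendors, as a named fact (statement only, `def … : Prop`, D-0014), the
derandomisation consequence of "`NP` is easy on average" due to Buhrman, Fortnow and Pavan, in
the form in which Hirahara uses it to derandomise his worst-case-to-average-case reduction for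
`Gap MINKT` (`GapMINKT.lean`, `GapMINKTProofs.lean`):

* `BuhrmanFortnowPavan2004_PromiseBPP'_subset_PromiseP` — *if `DistNP ⊆ AvgP` then
  `Promise-BPP = Promise-P`* (BFP, Thm. 3.1: "If NP is easy on average then pseudorandom
  generators exist and `P = BPP`"; quoted with the promise-class conclusion by Hirahara, ECCC
  TR18-138, proof of Cor. 4.23: "[BFP05] showed that `DistNP ⊆ AvgP` implies the existence of a
  pseudorandom generator, and in particular, `Promise-BPP = Promise-P`", and as Lemma 3.4 of
  Hirahara, Theory Comput. 19 (2023): a generator `G_n : {0,1}^{c log n} → {0,1}^n` that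
  `1/n`-fools size-`n` circuits).

and the proved corollary `…bpp_subset_P` (`DistNP ⊆ AvgP ⇒ BPP ⊆ P`, BFP's own wording).

## On the hypotheses (faithfulness)

BFP's "NP is easy on average" is Levin's `DistNP ⊆ Average-P` (languages in `NP` with
polynomial-time *computable* distributions, Levin's average polynomial time; BFP §2.1). The
library's `DistNP ⊆ AvgP` (`DistProblems.lean`) follows Bogdanov–Trevisan / Impagliazzo, exactly as
Hirahara's §3 does: `DistNP = (NP, PSamp)` and `AvgP` = errorless heuristic schemes. The fact is
vendored in Hirahara's conventions, i.e. as the sentence printed in the proof of his Cor. 4.23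
(and in Hirahara 2023, Lemma 3.4 / proof of Thm. 1.4: "by replacing random bits used by
randomized algorithms with the output of `G`, we obtain `Promise-BPP = Promise-P`"). BFP's proof
(Thm. 3.1: Impagliazzo–Wigderson 1997 + Babai–Fortnow–Lund/Nisan `EXP ⊆ P/poly ⇒ EXP = MA` +
Köbler–Schuler `MA = NP` + Ben-David–Chor–Goldreich–Luby `E = NE` + Impagliazzo–Kabanets–Wigderson)
only ever applies the average-case hypothesis to the uniform / tally-supported ensembles, which are
both P-computable and (exactly) P-samplable, and Levin's and Bogdanov–Trevisan's notions of
average polynomial time agree on ensembles of polynomial length (BT 2006, Prop. 2.6 =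
`mem_AvgP_iff_mem_AvgPLevin`). The conclusion is stated for the *textbook* promise class
`PromiseBPP'` (gap required on the promise only), which is what "Promise-BPP" means in both
sources; for the strong lift `PromiseBPP = promiseLift BPP ⊆ PromiseBPP'` it follows a fortiori.

Mathlib has no average-case classes or promise classes; nothing is duplicated (`lean search`
"Buhrman", "PromiseBPP", "derandom": only the anchors imported here).

## References

* H. Buhrman, L. Fortnow, A. Pavan, *Some results on derandomization*, Theory Comput. Syst. 38
  (2005) 211–227 (STACS 2003), Thm. 3.1; §2.1 (NP easy on average := DistNP ⊆ Average-P)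
  [BuhrmanFortnowPavan2004] (text checked: author copy lance.fortnow.com/papers/files/derand.pdf).
* S. Hirahara, *Non-black-box worst-case to average-case reductions within NP*, FOCS 2018; full
  version ECCC TR18-138 rev. 1 (2019), Cor. 4.23 and its proof [Hirahara2018].
* S. Hirahara, *Non-disjoint promise problems from meta-computational view of pseudorandom
  generator constructions*, Theory of Computing 19(4) (2023) 1–61, Lemma 3.4, proof of Thm. 1.4.
* R. Impagliazzo, A. Wigderson, *P = BPP if E requires exponential circuits*, STOC 1997.
* A. Bogdanov, L. Trevisan, *Average-case complexity*, FnT-TCS 2 (2006), Prop. 2.6.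
-/

namespace Literature.Computability.MetaComplexity

open _root_.Computability Complexity

/-- **Buhrman–Fortnow–Pavan (2005), Thm. 3.1, promise form.** *If `NP` is easy on average
(`DistNP ⊆ AvgP`) then pseudorandom generators exist; in particular `Promise-BPP = Promise-P`.*
Vendored as the inclusion `PromiseBPP' ⊆ PromiseP` of the textbook promise classes
(`Promise.lean`; the reverse inclusion is `PromiseP_subset_PromiseBPP'`), under the library's
Bogdanov–Trevisan-style hypothesis `DistNP ⊆ AvgP` (`DistProblems.lean`), which is the form
printed by Hirahara (ECCC TR18-138, proof of Cor. 4.23; Theory Comput. 2023, Lemma 3.4 and proof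
of Thm. 1.4) when invoking BFP; see the module docstring for the comparison with BFP's Levin-style
"`DistNP ⊆ Average-P`" (Hirahara 2018, proof of Cor. 4.23, is the printed sentence vendored here).
[cite: BuhrmanFortnowPavan2004, Thm. 3.1] -/
def BuhrmanFortnowPavan2004_PromiseBPP'_subset_PromiseP : Prop :=
  DistNP ⊆ AvgP → PromiseBPP' ⊆ PromiseP

/-- BFP's own wording of the conclusion, *`P = BPP`*: under `DistNP ⊆ AvgP`, every `BPP` language
is in `P` (a language is the promise problem with trivial promise, `PromiseProblem.ofLanguage`,
and `ofLanguage L ∈ PromiseBPP' ↔ L ∈ BPP`, `ofLanguage L ∈ PromiseP ↔ L ∈ P`).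
[cite: BuhrmanFortnowPavan2004, Thm. 3.1] -/
theorem BuhrmanFortnowPavan2004_PromiseBPP'_subset_PromiseP.bpp_subset_P
    (h : BuhrmanFortnowPavan2004_PromiseBPP'_subset_PromiseP) (hD : DistNP ⊆ AvgP) :
    BPP ⊆ Classes.P := by
  intro L hL
  obtain ⟨L', hL', p, hp⟩ := hL
  have hQ : PromiseProblem.ofLanguage L ∈ PromiseBPP' := by
    refine ⟨L', hL', p, fun x hx => ?_, fun x hx => ?_⟩
    · have hset : {y : List Bool | boolPair x y ∈ L'} = {y | boolPair x y ∈ L' ↔ x ∈ L} := by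
        ext y
        have hx' : x ∈ L := hx
        simp [hx']
      rw [hset]
      exact hp x
    · have hset : {y : List Bool | boolPair x y ∉ L'} = {y | boolPair x y ∈ L' ↔ x ∈ L} := by
        ext y
        have hx' : x ∉ L := hx
        simp [hx']
      rw [hset]
      exact hp x
  exact ofLanguage_mem_promiseLift_iff.1 (h hD hQ)

/-- Conversely to the fact's direction nothing is needed: `PromiseP ⊆ PromiseBPP'` always
(`PromiseZPPProofs.lean`), so under `DistNP ⊆ AvgP` the fact yields the *equality*
`PromiseBPP' = PromiseP` of Hirahara's sentence once that inclusion is supplied.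
[cite: Hirahara2018, proof of Cor. 4.23] -/
theorem BuhrmanFortnowPavan2004_PromiseBPP'_subset_PromiseP.eq
    (h : BuhrmanFortnowPavan2004_PromiseBPP'_subset_PromiseP) (hincl : PromiseP ⊆ PromiseBPP')
    (hD : DistNP ⊆ AvgP) : PromiseBPP' = PromiseP :=
  Set.Subset.antisymm (h hD) hincl

end Literature.Computability.MetaComplexity
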